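import Mathlib
import HarnessLib
import Summits.Ventures.LatticeQCDFlow.Scoring.OnePlaquetteBessel
import Summits.Ventures.LatticeQCDFlow.Scaling.AcceptanceVolumeDecayPi
import Summits.Ventures.LatticeQCDFlow.Scaling.AcceptanceEssEightNinthsDensities

/-!
# LatticeQCDFlow / Scaling — the UNTRAINED (identity-flow) baseline of the 2-d U(1) sampler in
# closed form: `ESS_V = (I₀(β)²/I₀(2β))^V`, `(8/9)·ESS_V ≤ acc_V ≤ (I₀(β/2)²/I₀(β))^V`

HONEST FRAMING: exact (Metropolis-corrected) sampling algorithms for lattice gauge theory;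
figures of merit are autocorrelation/cost numbers at stated couplings and volumes; no
continuum-physics claim.

Venture `LatticeQCDFlow` (cell pub-lqcd), topic `Scaling`; FANOUT row 3 (`s0-u1-a`, S0-B
implementation A: the 2-d U(1) flow sampler, GEN-12).  NEW WORK of the cell (closed forms, no
numerics): the figures of merit of the sampler whose flow is the IDENTITY — proposals drawn from
the product Haar (uniform) prior and Metropolis-corrected against the Wilson weight — for a
system of `V` INDEPENDENT PLAQUETTE ANGLES `θ ∈ (0, 2π]` with one-plaquette Wilson density
`e^{β cos θ}/Z(β)`, `Z(β) = 2π I₀(β)` (row 5's `Scoring.onePlaquetteZ_eq_besselI`, imported).  This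
product model is the 2-d U(1) Wilson theory with OPEN boundary conditions in a complete axial
gauge, where the plaquette angles are independent with exactly this law (a standard reduction, not
re-derived here; the periodic torus carries one global constraint and is NOT claimed — its
partition function is row 9's `Scoring/U1TorusPartitionFunctionBessel`).  The general-space laws
of row 3 (`Scaling/AcceptanceVolumeFloorPi`, `…DecayPi`, imported; Part II of the 8/9 law,
`Scaling/AcceptanceEssEightNinthsDensities`, imported) then give, for every real `β` and every
finite plaquette set of size `V`:

* one plaquette (`μ =` Lebesgue on `(0, 2π]`, target `p_β = e^{β cos θ}/Z(β)`, model `q = 1/(2π)`):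
  `integral_u1Wilson` (`∫ p_β = 1`), `integral_u1Haar` (`∫ q = 1`),
  **`integral_u1Wilson_sq_div`** (`∫ p_β²/q = I₀(2β)/I₀(β)²`, i.e. `ESS₁ = I₀(β)²/I₀(2β)`),
  **`integral_sqrt_u1Wilson_mul`** (`BC₁ = ∫ √(p_β q) = I₀(β/2)/√I₀(β)`);
* **`u1IdentityFlow_essFrac`** — `ESS_V = (I₀(β)²/I₀(2β))^V` EXACTLY;
* **`u1IdentityFlow_meanAccept_mem_Icc`** — `(8/9)·(I₀(β)²/I₀(2β))^V ≤ acc_V ≤ (I₀(β/2)²/I₀(β))^V`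
  (floor: the general-space 8/9 law on the product space; ceiling: the Bhattacharyya volume law).

Reading (value-free; no number of ours is computed or implied): the untrained exact sampler of the
factorised 2-d U(1) model has effective sample size decaying geometrically in the number of
plaquettes with ratio `I₀(β)²/I₀(2β)` (`< 1` for `β ≠ 0`, `∼ (πβ)^{-1/2}` as `β → ∞`) and
equilibrium acceptance pinned within a factor `9/8` of it below and by `(I₀(β/2)²/I₀(β))^V` above
— the closed-form zero-training row against which any trained flow's LEADERBOARD entry at the
same `(β, L)` is to be read.  NOT CLAIMED: the periodic-torus constraint; any value at the cell's
`(β, L)`; nothing re-scored, SEALED.md untouched.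
-/

namespace Summit.Ventures.LatticeQCDFlow.Theory2

open MeasureTheory Real Set Finset
open Literature.Analysis.FunctionSpaces (besselI besselI_zero_pos)
open Summit.Ventures.LatticeQCDFlow.Scoring (onePlaquetteZ onePlaquetteZ_pos onePlaquetteZ_eq_besselI)

/-! ## One plaquette: the Wilson density against the Haar model on `(0, 2π]` -/

section OnePlaquette

/-- `∫_{(0,2π]} e^{β cos θ} dθ = Z(β)`. [folklore] -/
theorem integral_Ioc_exp_mul_cos (β : ℝ) :
    ∫ θ in Ioc (0 : ℝ) (2 * π), Real.exp (β * Real.cos θ) = onePlaquetteZ β := by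
  rw [onePlaquetteZ, intervalIntegral.integral_of_le (by positivity : (0 : ℝ) ≤ 2 * π)]

/-- The Wilson one-plaquette density is positive. [folklore] -/
theorem u1Wilson_pos (β θ : ℝ) : 0 < Real.exp (β * Real.cos θ) / onePlaquetteZ β :=
  div_pos (Real.exp_pos _) (onePlaquetteZ_pos β)

/-- The Wilson one-plaquette density is measurable. [folklore] -/
theorem measurable_u1Wilson (β : ℝ) :
    Measurable fun θ : ℝ => Real.exp (β * Real.cos θ) / onePlaquetteZ β :=
  ((Real.continuous_exp.comp (continuous_const.mul Real.continuous_cos)).div_const _).measurable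

/-- `e^{γ cos θ}` is integrable on `(0, 2π]`. [folklore] -/
theorem integrableOn_exp_mul_cos (γ : ℝ) :
    Integrable (fun θ : ℝ => Real.exp (γ * Real.cos θ)) (volume.restrict (Ioc (0 : ℝ) (2 * π))) :=
  ((Real.continuous_exp.comp (continuous_const.mul Real.continuous_cos)).integrableOn_Icc).mono_set
    Ioc_subset_Icc_self

/-- The Wilson one-plaquette density is integrable on `(0, 2π]`. [folklore] -/
theorem integrable_u1Wilson (β : ℝ) :
    Integrable (fun θ : ℝ => Real.exp (β * Real.cos θ) / onePlaquetteZ β)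
      (volume.restrict (Ioc (0 : ℝ) (2 * π))) :=
  (integrableOn_exp_mul_cos β).div_const _

/-- `∫ p_β = 1`. [folklore] -/
theorem integral_u1Wilson (β : ℝ) :
    ∫ θ in Ioc (0 : ℝ) (2 * π), Real.exp (β * Real.cos θ) / onePlaquetteZ β = 1 := by
  rw [integral_div, integral_Ioc_exp_mul_cos, div_self (onePlaquetteZ_pos β).ne']

/-- The Haar model density `1/(2π)` is integrable on `(0, 2π]`. [folklore] -/
theorem integrable_u1Haar :
    Integrable (fun _ : ℝ => (1 / (2 * π) : ℝ)) (volume.restrict (Ioc (0 : ℝ) (2 * π))) := by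
  have : IsFiniteMeasure (volume.restrict (Ioc (0 : ℝ) (2 * π))) :=
    ⟨by rw [Measure.restrict_apply_univ, Real.volume_Ioc]; exact ENNReal.ofReal_lt_top⟩
  exact integrable_const _

/-- `∫ q = 1` for the Haar model on `(0, 2π]`. [folklore] -/
theorem integral_u1Haar : ∫ _θ in Ioc (0 : ℝ) (2 * π), (1 / (2 * π) : ℝ) = 1 := by
  rw [setIntegral_const, Real.volume_real_Ioc_of_le (by positivity), smul_eq_mul, sub_zero]
  field_simp

/-- `(e^{x})² = e^{2x}` in the form used below. [folklore] -/
theorem exp_mul_cos_sq (γ θ : ℝ) :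
    Real.exp (γ * Real.cos θ) ^ 2 = Real.exp (2 * γ * Real.cos θ) := by
  rw [← Real.exp_nat_mul]
  congr 1
  push_cast
  ring

/-- **The second weight moment of one plaquette**: `∫ p_β²/q = I₀(2β)/I₀(β)²`
(so `ESS₁ = I₀(β)²/I₀(2β)`). [ours] -/
theorem integral_u1Wilson_sq_div (β : ℝ) :
    ∫ θ in Ioc (0 : ℝ) (2 * π), (Real.exp (β * Real.cos θ) / onePlaquetteZ β) ^ 2 / (1 / (2 * π))
      = besselI 0 (2 * β) / besselI 0 β ^ 2 := by
  have e : ∀ θ : ℝ, (Real.exp (β * Real.cos θ) / onePlaquetteZ β) ^ 2 / (1 / (2 * π))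
      = 2 * π / onePlaquetteZ β ^ 2 * Real.exp (2 * β * Real.cos θ) := by
    intro θ
    rw [div_pow, exp_mul_cos_sq]
    field_simp
  simp_rw [e]
  rw [integral_const_mul, integral_Ioc_exp_mul_cos (2 * β), onePlaquetteZ_eq_besselI,
    onePlaquetteZ_eq_besselI]
  have hI : 0 < besselI 0 β := besselI_zero_pos β
  field_simp

/-- **The Bhattacharyya affinity of one plaquette**: `∫ √(p_β q) = I₀(β/2)/√(I₀(β))`. [ours] -/
theorem integral_sqrt_u1Wilson_mul (β : ℝ) :
    ∫ θ in Ioc (0 : ℝ) (2 * π),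
        Real.sqrt (Real.exp (β * Real.cos θ) / onePlaquetteZ β * (1 / (2 * π)))
      = besselI 0 (β / 2) / Real.sqrt (besselI 0 β) := by
  have hZ := onePlaquetteZ_pos β
  have e : ∀ θ : ℝ, Real.sqrt (Real.exp (β * Real.cos θ) / onePlaquetteZ β * (1 / (2 * π)))
      = Real.exp (β / 2 * Real.cos θ) / Real.sqrt (2 * π * onePlaquetteZ β) := by
    intro θ
    have hx : Real.exp (β * Real.cos θ) / onePlaquetteZ β * (1 / (2 * π))
        = Real.exp (β / 2 * Real.cos θ) ^ 2 / (2 * π * onePlaquetteZ β) := by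
      rw [exp_mul_cos_sq, show 2 * (β / 2) = β by ring]
      field_simp
    rw [hx, Real.sqrt_div (sq_nonneg _), Real.sqrt_sq (Real.exp_pos _).le]
  simp_rw [e]
  rw [integral_div, integral_Ioc_exp_mul_cos (β / 2), onePlaquetteZ_eq_besselI,
    onePlaquetteZ_eq_besselI, show 2 * π * (2 * π * besselI 0 β) = (2 * π) ^ 2 * besselI 0 β by ring,
    Real.sqrt_mul (sq_nonneg _), Real.sqrt_sq (by positivity)]
  have hI : 0 < Real.sqrt (besselI 0 β) := Real.sqrt_pos.2 (besselI_zero_pos β)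
  field_simp

/-- **`ESS₁ = I₀(β)²/I₀(2β)`** — the one-plaquette effective sample size of the Haar proposal
against the Wilson weight, in the density form `(∫p)²/∫p²/q`. [ours] -/
theorem u1IdentityFlow_essFrac_one (β : ℝ) :
    (∫ θ in Ioc (0 : ℝ) (2 * π), Real.exp (β * Real.cos θ) / onePlaquetteZ β) ^ 2
        / ∫ θ in Ioc (0 : ℝ) (2 * π),
          (Real.exp (β * Real.cos θ) / onePlaquetteZ β) ^ 2 / (1 / (2 * π))
      = besselI 0 β ^ 2 / besselI 0 (2 * β) := by
  rw [integral_u1Wilson, integral_u1Wilson_sq_div, one_pow, one_div, inv_div]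

end OnePlaquette

/-! ## `V` independent plaquettes: the identity flow's ESS and acceptance in closed form -/

section Plaquettes

variable {ι : Type*} [Fintype ι]

/-- **`ESS_V = (I₀(β)²/I₀(2β))^V` EXACTLY** for the identity flow on `V = card ι` independent
plaquettes (product Haar model against the product Wilson weight). [ours] -/
theorem u1IdentityFlow_essFrac (β : ℝ) :
    (∫ x, ∏ i : ι, Real.exp (β * Real.cos (x i)) / onePlaquetteZ β
        ∂(Measure.pi fun _ : ι => volume.restrict (Ioc (0 : ℝ) (2 * π)))) ^ 2
      / ∫ x, (∏ i : ι, Real.exp (β * Real.cos (x i)) / onePlaquetteZ β) ^ 2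
          / ∏ _i : ι, (1 / (2 * π) : ℝ)
        ∂(Measure.pi fun _ : ι => volume.restrict (Ioc (0 : ℝ) (2 * π)))
      = (besselI 0 β ^ 2 / besselI 0 (2 * β)) ^ Fintype.card ι := by
  rw [essFrac_pi_const (ι := ι) (ν := volume.restrict (Ioc (0 : ℝ) (2 * π)))
    (fun θ => Real.exp (β * Real.cos θ) / onePlaquetteZ β) (fun _ => (1 / (2 * π) : ℝ)),
    u1IdentityFlow_essFrac_one]

/-- **THE IDENTITY-FLOW ACCEPTANCE SANDWICH**: for `V = card ι` independent plaquettes,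
`(8/9)·(I₀(β)²/I₀(2β))^V ≤ acc_V ≤ (I₀(β/2)²/I₀(β))^V`, where
`acc_V = ∫∫ min(P(x)Q(x′), P(x′)Q(x))` is the equilibrium acceptance of the exact sampler
proposing from the product Haar prior (floor: the general-space 8/9 law applied on the product
space, with `ESS_V = (I₀(β)²/I₀(2β))^V`; ceiling: the Bhattacharyya volume law with
`BC₁² = I₀(β/2)²/I₀(β)`). [ours] -/
theorem u1IdentityFlow_meanAccept_mem_Icc (β : ℝ) :
    ∫ x, ∫ x', min ((∏ i : ι, Real.exp (β * Real.cos (x i)) / onePlaquetteZ β)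
          * ∏ _i : ι, (1 / (2 * π) : ℝ))
        ((∏ i : ι, Real.exp (β * Real.cos (x' i)) / onePlaquetteZ β) * ∏ _i : ι, (1 / (2 * π) : ℝ))
        ∂(Measure.pi fun _ : ι => volume.restrict (Ioc (0 : ℝ) (2 * π)))
        ∂(Measure.pi fun _ : ι => volume.restrict (Ioc (0 : ℝ) (2 * π)))
      ∈ Set.Icc (8 / 9 * (besselI 0 β ^ 2 / besselI 0 (2 * β)) ^ Fintype.card ι)
          ((besselI 0 (β / 2) ^ 2 / besselI 0 β) ^ Fintype.card ι) := by
  set ν : Measure ℝ := volume.restrict (Ioc (0 : ℝ) (2 * π)) with hν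
  have hp0 : ∀ θ : ℝ, 0 ≤ Real.exp (β * Real.cos θ) / onePlaquetteZ β := fun θ => (u1Wilson_pos β θ).le
  have hq0 : ∀ _θ : ℝ, (0 : ℝ) ≤ 1 / (2 * π) := fun _ => by positivity
  have hpm := measurable_u1Wilson β
  have hqm : Measurable fun _ : ℝ => (1 / (2 * π) : ℝ) := measurable_const
  have hpi := integrable_u1Wilson β
  have hqi := integrable_u1Haar
  constructor
  · -- floor: the 8/9 law on the product space
    obtain ⟨hP0, hPm, hPi, hP1⟩ := piDensity_facts (ι := ι) (μ := fun _ : ι => ν)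
      (p := fun _ θ => Real.exp (β * Real.cos θ) / onePlaquetteZ β) (fun _ => hp0) (fun _ => hpm)
      fun _ => hpi
    obtain ⟨hQ0, hQm, hQi, hQ1⟩ := piDensity_facts (ι := ι) (μ := fun _ : ι => ν)
      (p := fun _ _ => (1 / (2 * π) : ℝ)) (fun _ => hq0) (fun _ => hqm) fun _ => hqi
    rw [prod_eq_one fun i _ => integral_u1Haar] at hQ1
    rw [prod_eq_one fun i _ => integral_u1Wilson β] at hP1
    have hPpos : ∀ x : ι → ℝ, 0 < ∏ i, Real.exp (β * Real.cos (x i)) / onePlaquetteZ β :=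
      fun x => prod_pos fun i _ => u1Wilson_pos β (x i)
    have hQpos : ∀ _x : ι → ℝ, (0 : ℝ) < ∏ _i : ι, (1 / (2 * π) : ℝ) :=
      fun _ => prod_pos fun i _ => by positivity
    -- `W₂ = ∫ P/Q·P` is integrable and equals `(I₀(2β)/I₀(β)²)^V`
    have hW : ∀ x : ι → ℝ, (∏ i, Real.exp (β * Real.cos (x i)) / onePlaquetteZ β)
        / (∏ _i : ι, (1 / (2 * π) : ℝ)) * ∏ i, Real.exp (β * Real.cos (x i)) / onePlaquetteZ β
        = ∏ i, ((Real.exp (β * Real.cos (x i)) / onePlaquetteZ β) ^ 2 / (1 / (2 * π))) := by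
      intro x
      rw [← prod_div_distrib, ← prod_mul_distrib]
      exact prod_congr rfl fun i _ => by ring
    have hW1 : Integrable (fun θ : ℝ =>
        (Real.exp (β * Real.cos θ) / onePlaquetteZ β) ^ 2 / (1 / (2 * π))) ν := by
      have e : ∀ θ : ℝ, (Real.exp (β * Real.cos θ) / onePlaquetteZ β) ^ 2 / (1 / (2 * π))
          = 2 * π / onePlaquetteZ β ^ 2 * Real.exp (2 * β * Real.cos θ) := by
        intro θ
        rw [div_pow, exp_mul_cos_sq]
        field_simp
      simp_rw [e]
      exact (integrableOn_exp_mul_cos (2 * β)).const_mul _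
    have hW₂ : Integrable (fun x : ι → ℝ => (∏ i, Real.exp (β * Real.cos (x i)) / onePlaquetteZ β)
        / (∏ _i : ι, (1 / (2 * π) : ℝ)) * ∏ i, Real.exp (β * Real.cos (x i)) / onePlaquetteZ β)
        (Measure.pi fun _ : ι => ν) := by
      simp_rw [hW]
      exact Integrable.fintype_prod_dep (μ := fun _ : ι => ν) fun _ => hW1
    have hW₂val : ∫ x, (∏ i, Real.exp (β * Real.cos (x i)) / onePlaquetteZ β)
        / (∏ _i : ι, (1 / (2 * π) : ℝ)) * ∏ i, Real.exp (β * Real.cos (x i)) / onePlaquetteZ β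
        ∂(Measure.pi fun _ : ι => ν) = (besselI 0 (2 * β) / besselI 0 β ^ 2) ^ Fintype.card ι := by
      simp_rw [hW]
      rw [integral_fintype_prod_eq_prod (μ := fun _ : ι => ν)
        (fun (_ : ι) (θ : ℝ) => (Real.exp (β * Real.cos θ) / onePlaquetteZ β) ^ 2 / (1 / (2 * π))),
        prod_const, card_univ, integral_u1Wilson_sq_div]
    have h := meanAccept_overlapForm_ge_eight_ninths_ESS (μ := Measure.pi fun _ : ι => ν)
      hPpos hPm hPi hQpos hQm hQi hQ1 hW₂
    rw [hP1, hW₂val] at h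
    simp_rw [div_one] at h
    have hI2 : 0 < besselI 0 (2 * β) := besselI_zero_pos _
    have hI : 0 < besselI 0 β := besselI_zero_pos _
    calc 8 / 9 * (besselI 0 β ^ 2 / besselI 0 (2 * β)) ^ Fintype.card ι
        = 8 * 1 ^ 2 / (9 * (besselI 0 (2 * β) / besselI 0 β ^ 2) ^ Fintype.card ι) := by
          rw [div_pow, div_pow, one_pow]
          field_simp
      _ ≤ _ := h
  · -- ceiling: the Bhattacharyya volume law
    have h := (meanAccept_pi_const_mem_Icc (ι := ι) (ν := ν) hp0 hpm hpi hq0 hqm hqi).2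
    rw [integral_sqrt_u1Wilson_mul, div_pow, Real.sq_sqrt (besselI_zero_pos β).le] at h
    exact h

end Plaquettes

end Summit.Ventures.LatticeQCDFlow.Theory2
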